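import Summits.CriticalPhenomena.CardyFormulaZ2.Theorems.CardySelfRefinementLagHandOffStairCutsLegs
import HarnessLib

/-!
# Plane topology for the staircase cross-cuts, III: a rational staircase arc through a lattice edge

The registered stub `stub_quadTransfer_stairArcThrough` of line `hitting-tournament` of crux
`CardySelfRefinement.LagHandOff` (stmt-CriticalPhenomena-10268), method step (d) of
`stub_quadTransfer`: the plane-topology core of `NoIdleRel` for the target family `stairCuts D`
(`Theorems/CardySelfRefinementLagHandOffStairCuts.lean`).  For `U` open preconnected, `V ⊆ U` open
nonempty and a closed lattice edge `E = [h g, h g']` of a rational mesh `h` with `E ⊆ U`,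
`E ∩ V = ∅`, there is a simple arc `L`, a finite union of axis-parallel segments with rational
endpoints, with `E ⊆ L ⊆ U` and both endpoints in `V`.

Construction (`…StairCutsTopology.lean`, `…StairCutsLegs.lean`).  Two lattice points `x₁ ≠ x₂` of
a finer lattice in `V` and a tiny segment `σ` at `x₂` inside `V` (`exists_two_latticePoints`); a
first leg (`stub_quadTransfer_stairLeg`) inside `U ∖ E ∖ σ` (preconnected:
`isPreconnected_diff_arc` twice) from `x₁` to `G = h g` through the point `T₁ = G + δ_T d` of the
line of `E` beyond `G`; its trace
`Arc₁` meets `E` only at `G`, so `A₁ = Arc₁ ∪ E` is a simple arc from `x₁` to `G' = h g'` missing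
`x₂`; a second leg inside `U ∖ A₁` from `x₂` to `G'` through `T₂ = G' - δ₁ d` (beyond `G'`, closer
to `G'` than the first leg can come); glue (`IsSimpleArc.union`).
-/

noncomputable section

open Set Metric
open Literature.Topology.PlaneTopology Literature.Probability.LatticeModels
open Literature.Probability.Percolation

namespace Summit.CriticalPhenomena.CardyFormulaZ2.Cruxes.LagHandOff.HittingTournament

/-- **A rational staircase arc through a prescribed lattice edge** (registered stub
`stub_quadTransfer_stairArcThrough`; see the module docstring). -/
theorem stub_quadTransfer_stairArcThrough :
    ∀ (U V : Set ℂ), IsOpen U → IsPreconnected U → IsOpen V → V ⊆ U → V.Nonempty →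
      ∀ (h : ℚ), 0 < h → ∀ (g g' : Site 2), (zdGraph 2).Adj g g' →
        segment ℝ (meshPoint (h : ℝ) g) (meshPoint (h : ℝ) g') ⊆ U →
        Disjoint (segment ℝ (meshPoint (h : ℝ) g) (meshPoint (h : ℝ) g')) V →
        ∃ (L : Set ℂ) (S : Finset ((ℚ × ℚ) × (ℚ × ℚ))) (a b : ℂ),
          (∀ s ∈ S, s.1.1 = s.2.1 ∨ s.1.2 = s.2.2) ∧
          (L = ⋃ s ∈ S, segment ℝ (⟨(s.1.1 : ℝ), (s.1.2 : ℝ)⟩ : ℂ) ⟨(s.2.1 : ℝ), (s.2.2 : ℝ)⟩) ∧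
          Literature.Topology.PlaneTopology.IsSimpleArc L a b ∧ a ∈ V ∧ b ∈ V ∧
          segment ℝ (meshPoint (h : ℝ) g) (meshPoint (h : ℝ) g') ⊆ L ∧ L ⊆ U := by
  intro U V hU hUc hV hVU hVne h hh g g' hgg' hEU hEV
  have hhR : (0 : ℝ) < h := by exact_mod_cast hh
  have hmp_add : ∀ (δ : ℝ) (x y : Site 2), meshPoint δ (x + y) = meshPoint δ x + meshPoint δ y :=
    fun δ x y => by simp only [meshPoint, toComplex_add, mul_add]
  have hmp_sub : ∀ (δ : ℝ) (x y : Site 2), meshPoint δ (x - y) = meshPoint δ x - meshPoint δ y :=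
    fun δ x y => by simp only [meshPoint, toComplex_sub, mul_sub]
  -- the edge `E = [G, G']` and its line `ℓ t = G + t d`
  set G : ℂ := meshPoint (h : ℝ) g with hG
  set G' : ℂ := meshPoint (h : ℝ) g' with hG'
  set E : Set ℂ := segment ℝ G G' with hE
  set dv : Site 2 := g - g' with hdv
  have hdv0 : (zdGraph 2).Adj 0 dv := zdGraph_adj_zero_sub hgg'.symm
  set dh : ℂ := Site.toComplex dv with hdh
  have hdh1 : ‖dh‖ = 1 := by
    have := dist_meshPoint_of_adj (δ := 1) hdv0
    rw [abs_one, dist_comm, dist_eq_norm] at this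
    have h0 : Site.toComplex (0 : Site 2) = 0 := Complex.ext (by simp) (by simp)
    simpa [meshPoint, h0] using this
  have hdh0 : dh ≠ 0 := by
    intro h0
    rw [h0, norm_zero] at hdh1
    exact zero_ne_one hdh1
  set ℓ : ℝ →ᵃ[ℝ] ℂ := AffineMap.lineMap G (G + dh) with hℓ
  have hℓ_apply : ∀ t : ℝ, ℓ t = G + (t : ℂ) * dh := fun t => by
    rw [hℓ, AffineMap.lineMap_apply_module', add_sub_cancel_left, Complex.real_smul, add_comm]
  have hℓ_inj : Function.Injective ℓ :=
    AffineMap.lineMap_injective ℝ fun hGG => hdh0 (by simpa using hGG.symm)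
  have hℓ_dist : ∀ s t : ℝ, dist (ℓ s) (ℓ t) = |s - t| := fun s t => by
    rw [hℓ, dist_lineMap_lineMap, Real.dist_eq, dist_self_add_right, hdh1, mul_one]
  have hℓ_seg : ∀ s t : ℝ, segment ℝ (ℓ s) (ℓ t) = ℓ '' uIcc s t := fun s t => by
    rw [← image_segment, segment_eq_uIcc]
  have hG_ℓ : G = ℓ 0 := by
    rw [hℓ_apply]
    simp
  have hG'_ℓ : G' = ℓ (-h) := by
    rw [hℓ_apply, hG', hG, hdh, hdv]
    simp only [meshPoint, toComplex_sub]
    push_cast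
    ring
  have hE_ℓ : E = ℓ '' Icc (-(h : ℝ)) 0 := by
    rw [hE, hG_ℓ, hG'_ℓ, hℓ_seg, uIcc_of_ge (by linarith)]
  have hGG' : G ≠ G' := by
    rw [hG_ℓ, hG'_ℓ]
    exact fun e => absurd (hℓ_inj e) (by linarith)
  have hEarc : IsSimpleArc E G G' := IsSimpleArc.segment hGG'
  have hEc : IsCompact E := hEarc.isCompact
  have hGE : G ∈ E := left_mem_segment ℝ G G'
  have hG'E : G' ∈ E := right_mem_segment ℝ G G'
  -- a margin of `E` inside `U`
  obtain ⟨r₀, hr₀, hr₀U⟩ := hEc.exists_cthickening_subset_open hU hEU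
  have hnearU : ∀ z e, e ∈ E → dist z e ≤ r₀ → z ∈ U := fun z e he hd =>
    hr₀U (mem_cthickening_of_dist_le z e r₀ E he hd)
  -- two lattice points `x₁ ≠ x₂` of mesh `δ₀ = h / M₀` in `V` and a tiny segment `σ` at `x₂`
  obtain ⟨M₀, a₁, hM₀ne, hx₁V, hx₂V, hσV, hx₁σ, hx₂y₂ne⟩ := exists_two_latticePoints hV hVne hhR
  have hM₀pos : (0 : ℝ) < M₀ := by exact_mod_cast Nat.pos_of_ne_zero hM₀ne
  set δ₀ : ℝ := h / M₀ with hδ₀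
  have hδ₀pos : 0 < δ₀ := div_pos hhR hM₀pos
  set a₂ : Site 2 := a₁ + Pi.single 0 1 with ha₂
  set x₁ : ℂ := meshPoint δ₀ a₁ with hx₁
  set x₂ : ℂ := meshPoint δ₀ a₂ with hx₂
  set y₂ : ℂ := x₂ + ((δ₀ / 2 : ℝ) : ℂ) with hy₂
  set σ : Set ℂ := segment ℝ x₂ y₂ with hσ
  have hx₁E : x₁ ∉ E := fun h' => Set.disjoint_left.1 hEV h' hx₁V
  have hx₂E : x₂ ∉ E := fun h' => Set.disjoint_left.1 hEV h' hx₂V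
  have hσE : Disjoint σ E :=
    Set.disjoint_left.2 fun w hw hwE => Set.disjoint_left.1 hEV hwE (hσV hw)
  have hσarc : IsSimpleArc σ x₂ y₂ := IsSimpleArc.segment hx₂y₂ne
  have hx₂σ : x₂ ∈ σ := left_mem_segment ℝ x₂ y₂
  -- the region of the first leg
  set U₁ : Set ℂ := (U \ E) \ σ with hU₁
  have hU₁o : IsOpen U₁ := (hU.sdiff hEc.isClosed).sdiff hσarc.isCompact.isClosed
  have hU₁c : IsPreconnected U₁ :=
    isPreconnected_diff_arc (hU.sdiff hEc.isClosed) (isPreconnected_diff_arc hU hUc hEarc hEU)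
      hσarc (fun w hw => ⟨hVU (hσV hw), fun hwE => Set.disjoint_left.1 hσE hw hwE⟩)
  have hx₁U₁ : x₁ ∈ U₁ := ⟨⟨hVU hx₁V, hx₁E⟩, hx₁σ⟩
  have hEU₁ : ∀ e ∈ E, e ∉ U₁ := fun e he h' => h'.1.2 he
  have hx₂U₁ : x₂ ∉ U₁ := fun h' => h'.2 hx₂σ
  -- the first attachment point `T₁ = G + δ_T d` with `δ_T = δ₀ / M_T` small
  obtain ⟨ρσ, hρσ, hρσball⟩ : ∃ ρ > 0, ball G ρ ⊆ σᶜ :=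
    Metric.isOpen_iff.1 hσarc.isCompact.isClosed.isOpen_compl G
      (fun hGσ => Set.disjoint_left.1 hσE hGσ hGE)
  obtain ⟨M_T, hM_T⟩ := exists_nat_gt (δ₀ / min r₀ ρσ)
  have hmin : 0 < min r₀ ρσ := lt_min hr₀ hρσ
  have hM_Tpos : (0 : ℝ) < M_T := lt_trans (by positivity) hM_T
  have hM_Tne : M_T ≠ 0 := by
    rintro rfl
    simp at hM_Tpos
  set δT : ℝ := δ₀ / M_T with hδT
  have hδTpos : 0 < δT := div_pos hδ₀pos hM_Tpos
  have hδT_lt : δT < min r₀ ρσ := by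
    rw [hδT, div_lt_iff₀ hM_Tpos]
    rw [div_lt_iff₀ hmin] at hM_T
    linarith
  have hδTr₀ : δT < r₀ := hδT_lt.trans_le (min_le_left _ _)
  have hδTρσ : δT < ρσ := hδT_lt.trans_le (min_le_right _ _)
  set K : ℕ := M₀ * M_T with hK
  have hKne : K ≠ 0 := mul_ne_zero hM₀ne hM_Tne
  have hδT_eq : δT = (h : ℝ) / K := by
    rw [hδT, hδ₀, hK, Nat.cast_mul, div_div]
  set Qs : Site 2 := (K : ℤ) • g with hQs
  set X₁s : Site 2 := (M_T : ℤ) • a₁ with hX₁s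
  set T₁s : Site 2 := Qs + dv with hT₁s
  have hQT₁ : (zdGraph 2).Adj Qs T₁s := (zdGraph_adj_add_right_iff Qs dv).2 hdv0
  have eQs : meshPoint δT Qs = G := by
    rw [hδT_eq, hQs, meshPoint_div_smul hKne]
  have eX₁s : meshPoint δT X₁s = x₁ := by
    rw [hδT, hX₁s, meshPoint_div_smul hM_Tne]
  have eT₁s : meshPoint δT T₁s = ℓ δT := by
    rw [hT₁s, hmp_add, eQs, hℓ_apply]
    simp [meshPoint, hdh]
  have hT₁G : dist (ℓ δT) G = δT := by
    rw [hG_ℓ, hℓ_dist, sub_zero, abs_of_pos hδTpos]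
  have hT₁U : ℓ δT ∈ U := hnearU _ G hGE (by rw [hT₁G]; exact hδTr₀.le)
  have hT₁E : ℓ δT ∉ E := by
    rw [hE_ℓ]
    rintro ⟨t, ht, hte⟩
    have := hℓ_inj hte
    rw [this] at ht
    linarith [ht.2]
  have hT₁σ : ℓ δT ∉ σ := fun h' => hρσball (by rw [mem_ball, hT₁G]; exact hδTρσ) h'
  have hT₁U₁ : ℓ δT ∈ U₁ := ⟨⟨hT₁U, hT₁E⟩, hT₁σ⟩
  -- the first leg
  obtain ⟨Ms, leg₁, N₁, hMs, hleg₁, hN₁U₁, hfar₁, htr₁⟩ :=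
    stub_quadTransfer_stairLeg U₁ hU₁o hU₁c δT hδTpos X₁s Qs T₁s hQT₁ (by rw [eX₁s]; exact hx₁U₁)
      (by rw [eT₁s]; exact hT₁U₁)
  have hMspos : (0 : ℝ) < Ms := by exact_mod_cast Nat.pos_of_ne_zero hMs
  set δ₁ : ℝ := δT / Ms with hδ₁
  have hδ₁pos : 0 < δ₁ := div_pos hδTpos hMspos
  have hδ₁le : δ₁ ≤ δT := div_le_self hδTpos.le (by exact_mod_cast Nat.pos_of_ne_zero hMs)
  have run₁_eq : segment ℝ (meshPoint δT Qs) (meshPoint δT T₁s) = ℓ '' Icc 0 δT := by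
    rw [eQs, eT₁s, hG_ℓ, hℓ_seg, uIcc_of_le hδTpos.le]
  rw [run₁_eq] at htr₁
  have hrun₁U : ℓ '' Icc 0 δT ⊆ U := by
    rintro _ ⟨t, ht, rfl⟩
    refine hnearU _ G hGE ?_
    rw [hG_ℓ, hℓ_dist, sub_zero, abs_of_nonneg ht.1]
    linarith [ht.2]
  have hrun₁σ : ∀ t ∈ Icc (0 : ℝ) δT, ℓ t ∉ σ := fun t ht h' =>
    hρσball (by rw [mem_ball, hG_ℓ, hℓ_dist, sub_zero, abs_of_nonneg ht.1]; linarith [ht.2]) h'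
  set Arc₁ : Set ℂ := meshTrace δ₁ leg₁ with hArc₁
  have hArc₁sub : Arc₁ ⊆ N₁ ∪ ℓ '' Icc 0 δT := htr₁
  have hnil₁ : ¬ leg₁.Nil := by
    intro hn
    have e := hn.eq
    have : x₁ = G := by
      rw [← eX₁s, ← eQs, ← meshPoint_div_smul hMs X₁s, ← meshPoint_div_smul hMs Qs, e]
    exact hx₁E (this ▸ hGE)
  have hArc₁arc : IsSimpleArc Arc₁ x₁ G := by
    have := isSimpleArc_meshTrace hδ₁pos hleg₁ hnil₁
    rwa [hδ₁, meshPoint_div_smul hMs, meshPoint_div_smul hMs, eX₁s, eQs] at this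
  set A₁ : Set ℂ := Arc₁ ∪ E with hA₁
  have hA₁arc : IsSimpleArc A₁ x₁ G' := by
    refine hArc₁arc.union hEarc ?_
    rintro z ⟨hz₁, hzE⟩
    rcases hArc₁sub hz₁ with hz | ⟨t, ht, rfl⟩
    · exact absurd (hN₁U₁ hz) (hEU₁ z hzE)
    · rw [hE_ℓ] at hzE
      obtain ⟨s, hs, hst⟩ := hzE
      have hst' := hℓ_inj hst
      have ht0 : t = 0 := le_antisymm (hst' ▸ hs.2) ht.1
      rw [mem_singleton_iff, ht0, ← hG_ℓ]
  have hA₁U : A₁ ⊆ U := union_subset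
    (fun z hz => (hArc₁sub hz).elim (fun h' => (hN₁U₁ h').1.1) fun h' => hrun₁U h') hEU
  have hx₂A₁ : x₂ ∉ A₁ := by
    rintro (hz | hz)
    · rcases hArc₁sub hz with h' | ⟨t, ht, hte⟩
      · exact hx₂U₁ (hN₁U₁ h')
      · exact hrun₁σ t ht (hte ▸ hx₂σ)
    · exact hx₂E hz
  -- the region of the second leg and its attachment point `T₂ = G' - δ₁ d`
  set U₂ : Set ℂ := U \ A₁ with hU₂
  have hU₂o : IsOpen U₂ := hU.sdiff hA₁arc.isCompact.isClosed
  have hU₂c : IsPreconnected U₂ := isPreconnected_diff_arc hU hUc hA₁arc hA₁U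
  have hx₂U₂ : x₂ ∈ U₂ := ⟨hVU hx₂V, hx₂A₁⟩
  set N₁' : ℕ := K * Ms with hN₁'
  have hN₁'ne : N₁' ≠ 0 := mul_ne_zero hKne hMs
  have hδ₁_eq : δ₁ = (h : ℝ) / N₁' := by
    rw [hδ₁, hδT_eq, hN₁', hK]
    push_cast
    rw [div_div]
  set Gs' : Site 2 := (N₁' : ℤ) • g' with hGs'
  set T₂s : Site 2 := Gs' - dv with hT₂s
  set X₂s : Site 2 := ((M_T * Ms : ℕ) : ℤ) • a₂ with hX₂s
  have hQT₂ : (zdGraph 2).Adj Gs' T₂s := by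
    have := (zdGraph_adj_add_right_iff T₂s dv).2 hdv0
    rw [hT₂s, sub_add_cancel] at this
    exact this.symm
  have eGs' : meshPoint δ₁ Gs' = G' := by
    rw [hδ₁_eq, hGs', meshPoint_div_smul hN₁'ne]
  have eX₂s : meshPoint δ₁ X₂s = x₂ := by
    have : δ₁ = δ₀ / ((M_T * Ms : ℕ) : ℝ) := by rw [hδ₁, hδT, Nat.cast_mul, div_div]
    rw [this, hX₂s, meshPoint_div_smul (mul_ne_zero hM_Tne hMs)]
  have eT₂s : meshPoint δ₁ T₂s = ℓ (-h - δ₁) := by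
    rw [hT₂s, hmp_sub, eGs', hG'_ℓ, hℓ_apply, hℓ_apply]
    simp only [meshPoint, hdh]
    push_cast
    ring
  have hT₂G' : dist (ℓ (-h - δ₁)) G' = δ₁ := by
    rw [hG'_ℓ, hℓ_dist, show -(h : ℝ) - δ₁ - -h = -δ₁ by ring, abs_neg, abs_of_pos hδ₁pos]
  have hT₂U : ℓ (-h - δ₁) ∈ U := hnearU _ G' hG'E (by rw [hT₂G']; linarith)
  have hG'U₁ : G' ∉ U₁ := hEU₁ G' hG'E
  have hT₂A₁ : ℓ (-h - δ₁) ∉ A₁ := by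
    rintro (hz | hz)
    · rcases hArc₁sub hz with h' | ⟨t, ht, hte⟩
      · have := hfar₁ _ h' G' hG'U₁
        rw [hT₂G'] at this
        linarith
      · have := hℓ_inj hte
        rw [this] at ht
        linarith [ht.1]
    · rw [hE_ℓ] at hz
      obtain ⟨s, hs, hse⟩ := hz
      have := hℓ_inj hse
      rw [this] at hs
      linarith [hs.1]
  have hT₂U₂ : ℓ (-h - δ₁) ∈ U₂ := ⟨hT₂U, hT₂A₁⟩
  -- the second leg
  obtain ⟨M₃, leg₂, N₂, hM₃, hleg₂, hN₂U₂, -, htr₂⟩ :=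
    stub_quadTransfer_stairLeg U₂ hU₂o hU₂c δ₁ hδ₁pos X₂s Gs' T₂s hQT₂ (by rw [eX₂s]; exact hx₂U₂)
      (by rw [eT₂s]; exact hT₂U₂)
  have hM₃pos : (0 : ℝ) < M₃ := by exact_mod_cast Nat.pos_of_ne_zero hM₃
  set δ₃ : ℝ := δ₁ / M₃ with hδ₃
  have hδ₃pos : 0 < δ₃ := div_pos hδ₁pos hM₃pos
  have run₂_eq : segment ℝ (meshPoint δ₁ Gs') (meshPoint δ₁ T₂s) = ℓ '' Icc (-h - δ₁) (-h) := by
    rw [eGs', eT₂s, hG'_ℓ, hℓ_seg, uIcc_of_ge (by linarith)]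
  rw [run₂_eq] at htr₂
  have hrun₂U : ℓ '' Icc (-(h : ℝ) - δ₁) (-h) ⊆ U := by
    rintro _ ⟨t, ht, rfl⟩
    refine hnearU _ G' hG'E ?_
    rw [hG'_ℓ, hℓ_dist, abs_le]
    constructor <;> linarith [ht.1, ht.2]
  set Arc₂ : Set ℂ := meshTrace δ₃ leg₂ with hArc₂
  have hArc₂sub : Arc₂ ⊆ N₂ ∪ ℓ '' Icc (-(h : ℝ) - δ₁) (-h) := htr₂
  have hnil₂ : ¬ leg₂.Nil := by
    intro hn
    have e := hn.eq
    have : x₂ = G' := by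
      rw [← eX₂s, ← eGs', ← meshPoint_div_smul hM₃ X₂s, ← meshPoint_div_smul hM₃ Gs', e]
    exact hx₂E (this ▸ hG'E)
  have hArc₂arc : IsSimpleArc Arc₂ x₂ G' := by
    have := isSimpleArc_meshTrace hδ₃pos hleg₂ hnil₂
    rwa [hδ₃, meshPoint_div_smul hM₃, meshPoint_div_smul hM₃, eX₂s, eGs'] at this
  -- gluing
  set L : Set ℂ := A₁ ∪ Arc₂ with hL
  have hLarc : IsSimpleArc L x₁ x₂ := by
    refine hA₁arc.union hArc₂arc.symm ?_
    rintro z ⟨hzA, hz₂⟩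
    rw [mem_singleton_iff]
    rcases hArc₂sub hz₂ with hz | ⟨t, ht, rfl⟩
    · exact absurd hzA (hN₂U₂ hz).2
    · rcases hzA with hz₁ | hzE
      · rcases hArc₁sub hz₁ with h' | ⟨s, hs, hst⟩
        · have h1 := hfar₁ _ h' G' hG'U₁
          have h2 : dist (ℓ t) G' ≤ δ₁ := by
            rw [hG'_ℓ, hℓ_dist, abs_le]
            constructor <;> linarith [ht.1, ht.2]
          linarith
        · have := hℓ_inj hst
          rw [this] at hs
          linarith [hs.1, ht.2]
      · rw [hE_ℓ] at hzE
        obtain ⟨s, hs, hst⟩ := hzE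
        have hst' := hℓ_inj hst
        subst hst'
        have : s = -h := le_antisymm ht.2 hs.1
        rw [this, ← hG'_ℓ]
  have hLU : L ⊆ U := union_subset hA₁U
    (fun z hz => (hArc₂sub hz).elim (fun h' => (hN₂U₂ h').1) fun h' => hrun₂U h')
  -- rational description
  obtain ⟨S₁, hS₁, hS₁eq⟩ := exists_finset_meshTrace (h / (N₁' : ℚ)) leg₁
  obtain ⟨S₂, hS₂, hS₂eq⟩ := exists_finset_meshTrace (h / ((N₁' * M₃ : ℕ) : ℚ)) leg₂
  obtain ⟨S₀, hS₀, hS₀eq⟩ := exists_finset_edge h hgg'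
  have e₁ : ((h / (N₁' : ℚ) : ℚ) : ℝ) = δ₁ := by
    rw [hδ₁_eq]
    push_cast
    rfl
  have e₂ : ((h / ((N₁' * M₃ : ℕ) : ℚ) : ℚ) : ℝ) = δ₃ := by
    rw [hδ₃, hδ₁_eq]
    push_cast
    rw [div_div]
  rw [e₁] at hS₁eq
  rw [e₂] at hS₂eq
  refine ⟨L, S₁ ∪ S₀ ∪ S₂, x₁, x₂, ?_, ?_, hLarc, hx₁V, hx₂V, fun z hz => Or.inl (Or.inr hz), hLU⟩
  · intro s hs
    simp only [Finset.mem_union] at hs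
    rcases hs with (hs | hs) | hs
    exacts [hS₁ s hs, hS₀ s hs, hS₂ s hs]
  · rw [Finset.set_biUnion_union, Finset.set_biUnion_union, ← hS₁eq, ← hS₀eq, ← hS₂eq]

end Summit.CriticalPhenomena.CardyFormulaZ2.Cruxes.LagHandOff.HittingTournament

end
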